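import Literature.AnabelianGeometry.EtaleTheta.Discharge.Sec4GaloisActionToyProp43iii
import Literature.AnabelianGeometry.EtaleTheta.Discharge.Sec4Prop42SubBaseLiftNegative
import HarnessLib

/-!
# [EtTh] Prop 4.2 (iii), proof row L03 `Prop42Sub.BaseFrobeniusLift` (FACT-LIST F-2796): an INSTANCE FORM —
# head-form, hypothesis-free, NON-VACUOUS — at the Galois-action toy `ToyGal.S` (free condition-(e) slot)

S. Mochizuki, *The étale theta function and its Frobenioid-theoretic manifestations*, Publ. RIMS **45** (2009) [EtTh],
§4, Prop. 4.2 (iii), proof PDF p. 89 l. 83 – p. 90 l. 6 (printed pp. 315–316): «since the Frobenioid `C` is of model [hence, in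
particular, pre-model] type [cf. Theorem 3.7, (i)], it follows that `C` admits a base-Frobenius pair [cf. [FrdI], Definition 2.7,
(iii)]» [cite: MochizukiEtTh2009, Prop 4.2 p.89]; Def. 4.1 (iv) p. 87 («of base-Frobenius type», conditions (a)–(e)).

abc-iut cell, block F (instance-form batch INST59J2), seat abc-iut-f-110 (gen 6).  FACT-LIST row **F-2796**
`Literature.AnabelianGeometry.EtaleTheta.BiKummerSetting.Prop42Sub.BaseFrobeniusLift S` (abc-iut-w5-d134, frozen `Prop42Sub.lean`,
sub-DAG row L03; SUPERSEDED as a reading of print by L03′ `BaseFrobeniusLiftUpToUnit` after finding F-w4d044-1): for every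
`N`, every Frobenius-trivial Galois `μ_N`-saturated `A′` and every pull-back morphism `φ : A′ → A_⊙`, an isometry `α : A′ → A_⊙` of
Frobenius degree `N` with data of base-Frobenius type whose pull-back part IS `φ`.  Kernel status before this file
(LF-KERNEL-STATUS col. 14): closure REFUTERS only (`ToyCov.not_baseFrobeniusLift_and_baseFrobeniusLiftUpToUnit`,
`Prop42Sub.not_forall_baseFrobeniusLift`) and conditional refuters (`not_baseFrobeniusLift_of_unit`, `…_mkOfModelCanonical`:
under the CANONICAL reading of condition (e) — [FrdI] Def. 2.7 (iii), `mkOfModelCanonical` — a non-trivial unit of `A_⊙`, indeed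
any `C`-isomorphism between distinct objects (`eq_of_baseFrobeniusTypeData_of_isIso`), can never be the pull-back part) — NO
positive instance of any kind: whether the typed row is even satisfiable at a datum meeting its premises was not on record.

THIS FILE (PROOF-ONLY: 0 `def`, 0 `instance`, no new `Prop`; inputs BY NAME from abc-iut-f-111's toy files
`Sec4GaloisActionToy(Prop43iii).lean` and abc-iut-L1's model-Frobenioid dictionary) proves

* **`ToyGal.baseFrobeniusLift_S : BaseFrobeniusLift ToyGal.S`** — the row HOLDS, hypothesis-free, at abc-iut-f-111's §4 toy
  setting `ToyGal.S` (base `D = B(ℤ) ⊔ {top}`, `Φ = ℚ_{≥0}`, `B = ℤ × (ℤ × ℤ)` with the SHEAR Galois action, `A_⊙ = (top, 0)`; the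
  birational vocabulary and the condition-(e) slot `ArisesFromBaseFrobeniusPair` are FREE, `:= True`).  The premises are met
  there (e.g. `N = 1`, `A′ = A_⊙`, `φ = id`; also every unit- or class-twist `(top, n·𝔭)`, `(gen, n·𝔭)` of `A_⊙` with its
  pull-back isomorphism / covering map), so the instance is NOT vacuous.  CONSTRUCTION for a given `(N, A′, φ)`: `φ` is linear with
  `Div = 0` (abc-iut-L1's `degFr_div_of_isPullbackMorphism`), so `cls(A′) = Div_B(u_φ)`; put `α″ := (N, id, 0, u_φ^{N−1}·z)` with the
  constant `z := (0, −N·a_φ, 0)` chosen so that the rational function `u_α = u_φ^N·z` of `α := φ ∘ α″` has VANISHING shear-sensitive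
  constant — then `α` is an isometry of Frobenius degree `N`, `α″` a base-identity endomorphism of Frobenius type, and the group
  `G` of condition (b) is `1` over `top` (`Aut_D(top) = 1`) resp. the cyclic group generated by the lift `γ₁ = (1, t, 0, 1)` of the
  generator `t ∈ ℤ = Aut_D(gen)` over `gen`, which lies in `Aut_{C_{A_⊙}}(α)` exactly because the shear fixes `u_α`
  (`exists_subgroup_bijOn_galOver`); (a) = the premises, (d) = `φ`, (e) = the free slot.
* the toy lemmas it needs: `pullGp_Φ_eq` (pull-back on `Φ^gp` is the identity), `Bmap_eq_self_of_fst_snd_eq_one` /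
  `pull_ratFn_eq_self` (the Galois action fixes rational functions with trivial first constant).

HONEST LABEL «INSTANCE at toy carrier with FREE condition-(e) slot»: this is a CONSISTENCY certificate for the typed row L03 —
it is satisfiable (non-vacuously) precisely because (e) is uninterpreted at `ToyGal.S`; under the canonical reading of (e) the row
is refuted at every model with a non-trivial unit or class-twist of `A_⊙` (the tree's negatives above), which is why the cell
reads print through L03′.  An instance-form theorem about OUR typed statement ≠ a theorem about [EtTh] in print; the universal
closure stays refuted; nothing here bears on, or takes a side on, [IUTchIII] Cor. 3.12; typed ≠ proved.
-/

noncomputable section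

namespace Literature.AnabelianGeometry.EtaleTheta

open CategoryTheory Opposite Literature.AlgebraicGeometry.Frobenioids
open scoped NNRat

namespace ToyGal

/-! ## Toy lemmas: pull-backs on `Φ^gp` are trivial; the shear fixes rational functions with trivial first constant -/

/-- Pull-back on `Φ^gp = (ℚ_{≥0})^gp` along ANY base arrow of the toy is the identity (`Φ` is the constant monoid;
abc-iut-f-111's `pull_Φ_eq` on generators). [cite: MochizukiEtTh2009, Def 3.6 p.76] -/
theorem pullGp_Φ_eq {X Y : Base} (f : X ⟶ Y) (c : Algebra.GrothendieckGroup (S.tf.divisorMonoid.obj (op Y))) :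
    pullGp S.tf.divisorMonoid f c = c := by
  have h : pullGp S.tf.divisorMonoid f = MonoidHom.id _ :=
    MonGp.hom_ext fun a => by
      rw [pullGp_of]
      exact congrArg Algebra.GrothendieckGroup.of (pull_Φ_eq f a)
  rw [h]
  rfl

/-- The Galois action / pull-back `Bmap f` on `B = ℤ × (ℤ × ℤ)` (shear along `Aut(gen)`, projection along `gen → top`,
identity on `top`) FIXES every rational function whose first constant `a` is trivial. [cite: MochizukiEtTh2009, Def 3.6 p.77] -/
theorem Bmap_eq_self_of_fst_snd_eq_one {X Y : Base} (f : X ⟶ Y) (x : Bgrp) (hx : x.2.1 = 1) : Bmap f x = x := by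
  cases X with
  | star =>
    cases Y with
    | of y => exact (WithTerminal.false_of_from_star f).elim
    | star => rfl
  | of _ =>
    cases Y with
    | of _ =>
      change (x.1, (x.2.1, x.2.1 ^ (Multiplicative.toAdd (show Multiplicative ℤ from WithTerminal.down f)) * x.2.2)) = x
      rw [hx, one_zpow, one_mul, ← hx]
    | star =>
      change (x.1, ((1 : Multiplicative ℤ), x.2.2)) = x
      rw [← hx]

/-- Hence pull-back along an endomorphism `f` of a base object fixes every element of the rational-function monoid
`B(Y) = B₀^Λ ×_{(Φ^ℝ)^gp} Φ^gp` of the toy tempered Frobenioid whose first constant is trivial (componentwise: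
`Bmap_eq_self_of_fst_snd_eq_one` and `pullGp`-triviality). [cite: MochizukiEtTh2009, Def 3.6 p.77] -/
theorem pull_ratFn_eq_self {Y : Base} (f : Y ⟶ Y) (u : S.tf.ratFnFunctor.obj (op Y)) (hu : u.1.1.2.1 = 1) :
    pull S.tf.ratFnFunctor f u = u := by
  apply Subtype.ext
  apply Prod.ext
  · change Bmap f u.1.1 = u.1.1
    exact Bmap_eq_self_of_fst_snd_eq_one f u.1.1 hu
  · change gpMap (S.tf.Φ.pull f.op) u.1.2 = u.1.2
    have h : gpMap (S.tf.Φ.pull f.op) = MonoidHom.id _ :=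
      MonGp.hom_ext fun a => by
        rw [MonoidHom.id_apply]
        change MonGp.map _ _ = _
        rw [MonGp.map_of]
        exact congrArg Algebra.GrothendieckGroup.of (pull_Φ_eq f a)
    rw [h, MonoidHom.id_apply]

/-! ## Condition (b) of Def. 4.1 (iv): the subgroup `G ⊆ Aut_{C_{A_⊙}}(α)` mapping isomorphically onto `Gal(A′^bs/A_⊙^bs)` -/

/-- **Def. 4.1 (iv)(b) at the toy.** For every object `A′` and every `α : A′ → A_⊙ = (top, 0)` whose rational function `u_α`
has trivial first constant, there is a subgroup `G ⊆ Aut_{C_{A_⊙}}(α) ⊆ Aut_C(A′)` which `Base` maps bijectively onto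
`Gal(A′^bs/A_⊙^bs) = Aut_D(A′^bs)` (everything is over the terminal `top`): over `top`, `G := 1` (`Aut_D(top) = 1`); over (a
copy of) `gen`, `G :=` the cyclic group generated by the lift `γ₁ := (1, t, 0, 1)` of the generator `t = 1 ∈ ℤ = Aut_D(gen)`
— an automorphism of `A′` ([FrdI] Thm. 5.2: `isIso_of`) lying OVER `α` because the shear `t^*` fixes `u_α`
(`pull_ratFn_eq_self`) and `Div(α) ∈ Φ` is pull-back invariant; `Base(γ₁^k) = t^k` is a bijection `γ₁^ℤ → ℤ`.
[cite: MochizukiEtTh2009, Def 4.1 p.87] -/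
theorem exists_subgroup_bijOn_galOver (A' : S.C) (α : A' ⟶ S.Aodot)
    (hunit : (ModelFrobenioid.unit α).1.1.2.1 = 1) :
    ∃ G : Subgroup (Aut A'), G ≤ S.autOver α ∧ Set.BijOn (S.autBase A') G (S.galOver α) := by
  obtain ⟨Y, c⟩ := A'
  cases Y with
  | star =>
    refine ⟨⊥, bot_le, fun σ hσ => ?_, fun σ hσ τ hτ _ => ?_, fun τ _ => ⟨1, (⊥ : Subgroup _).one_mem, ?_⟩⟩
    · rw [show σ = 1 from hσ, map_one]
      exact one_mem _
    · exact (show σ = 1 from hσ).trans (show τ = 1 from hτ).symm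
    · rw [map_one]
      exact (aut_top_eq_one τ).symm
  | of x =>
    -- the lift `γ₁ = (1, t, 0, 1)` of the generator `t = 1 ∈ ℤ = Aut_D(gen)` to an automorphism of `A' = (gen, c)`
    set t : Multiplicative ℤ := Multiplicative.ofAdd 1 with ht
    let γh : (⟨WithTerminal.of x, c⟩ : S.C) ⟶ ⟨WithTerminal.of x, c⟩ :=
      ModelFrobenioid.mkHom _ _ 1 (autOf x t).hom 1 1 (by
        rw [PNat.one_coe, pow_one, map_one, mul_one, map_one, mul_one, pullGp_Φ_eq])
    haveI : IsIso (ModelFrobenioid.baseMap γh) := by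
      change IsIso (autOf x t).hom
      infer_instance
    haveI : IsIso γh := ModelFrobenioid.isIso_of S_ratFnFunctor_isGroupLike γh rfl rfl
    let γ₁ : Aut (⟨WithTerminal.of x, c⟩ : S.C) := asIso γh
    have hγ₁base : S.autBase _ γ₁ = autOf x t := Iso.ext rfl
    have hγ₁pow : ∀ k : ℤ, S.autBase _ (γ₁ ^ k) = autOf x (t ^ k) := fun k => by
      rw [map_zpow, hγ₁base, map_zpow]
    have htk : ∀ k : ℤ, t ^ k = Multiplicative.ofAdd k := fun k => by
      rw [ht, ← ofAdd_zsmul, smul_eq_mul, mul_one]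
    have hγ₁over : γ₁ ∈ S.autOver α := by
      change γh ≫ α = α
      refine ModelFrobenioid.hom_ext ?_ ?_ ?_ ?_
      · rw [ModelFrobenioid.degFr_comp]
        change ModelFrobenioid.degFr α * 1 = _
        rw [mul_one]
      · exact WithTerminal.starTerminal.hom_ext _ _
      · rw [ModelFrobenioid.div_comp]
        change pull S.tf.divisorMonoid (autOf x t).hom (ModelFrobenioid.div α) * 1 ^ _ = _
        rw [pull_Φ_eq, one_pow, mul_one]
      · rw [ModelFrobenioid.unit_comp]
        change pull S.tf.ratFnFunctor (autOf x t).hom (ModelFrobenioid.unit α) * 1 ^ _ = _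
        rw [pull_ratFn_eq_self _ _ hunit, one_pow, mul_one]
    refine ⟨Subgroup.zpowers γ₁, (Subgroup.zpowers_le).2 hγ₁over, fun σ _ => ?_, fun σ hσ τ hτ hστ => ?_,
      fun τ _ => ?_⟩
    · exact WithTerminal.starTerminal.hom_ext _ _
    · obtain ⟨i, rfl⟩ := Subgroup.mem_zpowers_iff.1 hσ
      obtain ⟨j, rfl⟩ := Subgroup.mem_zpowers_iff.1 hτ
      rw [hγ₁pow, hγ₁pow, htk, htk] at hστ
      have hij : (Multiplicative.ofAdd i : Multiplicative ℤ) = Multiplicative.ofAdd j :=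
        congrArg (fun e : Aut (WithTerminal.of x : Base) => (WithTerminal.down e.hom : Multiplicative ℤ)) hστ
      rw [Multiplicative.ofAdd.injective hij]
    · obtain ⟨g, rfl⟩ := autOf_surjective x τ
      refine ⟨γ₁ ^ (Multiplicative.toAdd g), Subgroup.zpow_mem_zpowers _ _, ?_⟩
      rw [hγ₁pow, htk, ofAdd_toAdd]

/-! ## The instance form -/

/-- **F-2796 `Prop42Sub.BaseFrobeniusLift`, INSTANCE FORM (head-form, 0 hypotheses, non-vacuous) at abc-iut-f-111's toy §4
setting `ToyGal.S`** («INSTANCE at toy carrier with FREE condition-(e) slot»).  Given `N`, a Frobenius-trivial Galois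
`μ_N`-saturated `A′` and a pull-back morphism `φ : A′ → A_⊙`: `φ = (1, Base φ, 0, u_φ)` with `cls(A′) = Div_B(u_φ)`;
`α″ := (N, id, 0, u_φ^{N−1}·z)`, `z := (0, −N·a_φ, 0)`; `α := φ ∘ α″ = (N, Base φ, 0, u_φ^N·z)` is an isometry of Frobenius
degree `N` whose rational function has trivial first constant; the data of base-Frobenius type are `(G, α′ := φ, α″)` with `G`
from `exists_subgroup_bijOn_galOver`, (a) the premises, (c) `α″` base-identity of Frobenius type (abc-iut-L1's
`ModelFrobenioid.isCoAngular`), (d) `φ`, (e) the free slot.  CONSISTENCY certificate for the typed (superseded) row L03 only.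
[cite: MochizukiEtTh2009, Prop 4.2 p.89] -/
theorem baseFrobeniusLift_S :
    Literature.AnabelianGeometry.EtaleTheta.BiKummerSetting.Prop42Sub.BaseFrobeniusLift S := by
  intro N A' φ hφ hft hgal hμ
  obtain ⟨hdeg, hdiv⟩ := ModelFrobenioid.degFr_div_of_isPullbackMorphism S_divisorMonoid_isDivisorial hφ
  have hAodot : S.Aodot.cls = 1 := rfl
  have hrel : A'.cls = divB S.tf.divisorMonoid S.tf.ratFnFunctor S.tf.divBNatTrans (op A'.base) (ModelFrobenioid.unit φ) := by
    have h := ModelFrobenioid.rel φ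
    rw [hdeg, hdiv, PNat.one_coe, pow_one, map_one, mul_one, hAodot, map_one, one_mul] at h
    exact h
  -- the correcting constant `z = (0, -N·a_φ, 0)` (kills the shear-sensitive constant of `u_α`) and `u₂ := u_φ^(N-1) · z`
  set u := ModelFrobenioid.unit φ
  let z : S.tf.ratFnFunctor.obj (op A'.base) :=
    ⟨(((1 : Multiplicative ℤ), ((u.1.1.2.1 ^ (N : ℕ))⁻¹, (1 : Multiplicative ℤ))), 1), by
      change divHom ((1 : Multiplicative ℤ), ((u.1.1.2.1 ^ (N : ℕ))⁻¹, (1 : Multiplicative ℤ))) = S.tf.ΦgpToRlog _ 1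
      rw [map_one]
      change Toy.divHomQ 1 = 1
      exact map_one _⟩
  have hz : divB S.tf.divisorMonoid S.tf.ratFnFunctor S.tf.divBNatTrans (op A'.base) z = 1 := rfl
  -- `α₂ := (N, id, 0, u^(N-1)·z)`, `α := φ ∘ α₂`
  have hNpred : ((N : ℕ) - 1) + 1 = (N : ℕ) := Nat.succ_pred_eq_of_pos N.pos
  let u₂ : S.tf.ratFnFunctor.obj (op A'.base) := u ^ ((N : ℕ) - 1) * z
  have hu₂ : divB S.tf.divisorMonoid S.tf.ratFnFunctor S.tf.divBNatTrans (op A'.base) u₂ = A'.cls ^ ((N : ℕ) - 1) := by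
    change divB S.tf.divisorMonoid S.tf.ratFnFunctor S.tf.divBNatTrans (op A'.base) (u ^ ((N : ℕ) - 1) * z) = _
    rw [map_mul, map_pow, hz, mul_one, ← hrel]
  let α₂ : A' ⟶ A' := ModelFrobenioid.mkHom A' A' N (𝟙 _) 1 u₂ (by
    rw [map_one, mul_one, pullGp_id, hu₂, ← pow_succ', hNpred])
  let α : A' ⟶ S.Aodot := α₂ ≫ φ
  have hαdeg : ModelFrobenioid.degFr α = N := by
    change ModelFrobenioid.degFr φ * N = N
    rw [hdeg, one_mul]
  have hαdiv : ModelFrobenioid.div α = 1 := by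
    change pull S.tf.divisorMonoid (𝟙 _) (ModelFrobenioid.div φ) * (1 : S.tf.divisorMonoid.obj (op A'.base)) ^ _ = 1
    rw [hdiv, map_one, one_pow, mul_one]
  have hαunit : ModelFrobenioid.unit α = u ^ (N : ℕ) * z := by
    change pull S.tf.ratFnFunctor (𝟙 _) u * u₂ ^ (ModelFrobenioid.degFr φ : ℕ) = _
    rw [pull_id, hdeg, PNat.one_coe, pow_one]
    change u * (u ^ ((N : ℕ) - 1) * z) = _
    rw [← mul_assoc, ← pow_succ', hNpred]
  have hαunit1 : (ModelFrobenioid.unit α).1.1.2.1 = 1 := by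
    rw [hαunit]
    change u.1.1.2.1 ^ (N : ℕ) * (u.1.1.2.1 ^ (N : ℕ))⁻¹ = 1
    exact mul_inv_cancel _
  obtain ⟨G, hGle, hGbij⟩ := exists_subgroup_bijOn_galOver A' α hαunit1
  refine ⟨α,
    { G := G
      G_le := hGle
      α₂ := α₂
      α₁ := φ
      fac := rfl
      isFrobeniusTrivial := hft
      isGalois := hgal
      isMuSaturated := by rw [show S.degFr α = N from hαdeg]; exact hμ
      mapsIsomorphically := hGbij
      cond_c := ⟨rfl, ⟨ModelFrobenioid.isCoAngular S_ratFnFunctor_isGroupLike _, rfl⟩,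
        show IsIso (𝟙 A'.base) from inferInstance⟩
      cond_d := hφ
      cond_e := trivial }, rfl, hαdiv, hαdeg⟩

/-- **The instance is NOT vacuous**: the premises of the row are met at `ToyGal.S` — e.g. `N = 1`, `A′ = A_⊙`, `φ = id` (an
isomorphism is a pull-back morphism; `A_⊙` is Frobenius-trivial and Galois by the setting; every object is `μ_1`-saturated,
abc-iut-w4-d044's `Prop42Sub.isMuSaturated_one`). [cite: MochizukiEtTh2009, Prop 4.2 p.89] -/
theorem baseFrobeniusLift_S_premises_inhabited :
    ∃ (N : ℕ+) (A' : S.C) (φ : A' ⟶ S.Aodot),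
      S.IsPullback φ ∧ S.IsFrobeniusTrivial A' ∧ S.IsGalois A' ∧ S.IsMuSaturated A' N :=
  ⟨1, S.Aodot, 𝟙 _, PreFrobenioid.isPullbackMorphism_of_isIso S.F (𝟙 _), S.isFrobeniusTrivial_Aodot, S.isGalois_Aodot,
    BiKummerSetting.Prop42Sub.isMuSaturated_one S S.Aodot⟩

end ToyGal

end Literature.AnabelianGeometry.EtaleTheta

end
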